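import Summits.RiemannHypothesis.RiemannHypothesis.Theses.RuelleBand
import Literature.NumberTheory.LFunctions.DeBruijnHZeroProofs
import Literature.NumberTheory.LFunctions.RiemannXiProofs
import Literature.NumberTheory.LFunctions.DeBruijnNewmanFacts

/-!
# `CofiniteCriticalLine` (crux stmt-RiemannHypothesis-2064) is the endpoint `t = 0` of the Ki–Kim–Lee theorem

The crux of route RuelleBand, rank 5, is
`CofiniteCriticalLine := {s : ℂ | riemannZeta s = 0 ∧ 0 < s.re ∧ s.re < 1 ∧ s.re ≠ 1 / 2}.Finite`.

Ki–Kim–Lee (Adv. Math. 222 (2009), Thm. 1.3; tree named fact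
`Literature.NumberTheory.LFunctions.ki_kim_lee_finite`) prove, for de Bruijn's deformation
`H_t(z) = ∫₀^∞ e^{tu²} Φ(u) cos(zu) du` of `H_0(z) = ξ(1/2 + iz/2)/8`:
for every `t > 0` there is `T` with every zero `z` of `H_t`, `|Re z| ≥ T`, real — "all but finitely many
zeros of `H_t` are real". This file proves, kernel-checked (refuter's standing-adversary output, cdisprove
cycle 1), that the SAME statement at the excluded endpoint `t = 0` is exactly the crux:

* `cofiniteCriticalLine_iff_kiKimLee_at_zero :
    CofiniteCriticalLine ↔ ∃ T : ℝ, ∀ z : ℂ, deBruijnH 0 z = 0 → T ≤ |z.re| → z.im = 0`;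
* `kiKimLee_closed_iff : (∀ t ≥ 0, ∃ T, …) ↔ ki_kim_lee_finite ∧ CofiniteCriticalLine`.

So the crux asks whether the Ki–Kim–Lee threshold survives the limit `t → 0⁺` (by Hurwitz's theorem a
threshold `T(t)` bounded on some `(0, δ)` would suffice); RH itself is `Λ = 0`, i.e. "no exception at all at
`t = 0`" (`riemannHypothesis_iff_hasOnlyRealZeros_deBruijnH_zero`). Inputs: `deBruijnH_zero_eq_holds`
(`H_0 = ξ(1/2 + iz/2)/8`) and `riemannXi_eq_zero_iff_holds` (zeros of `ξ` = zeros of `ζ` in the open strip),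
both proved in tree; Mathlib `IsCompact.inter_riemannZetaZeros_finite`.
-/

noncomputable section

open Complex Set

namespace Summit.RiemannHypothesis.Cruxes.CofiniteCriticalLine.Negative

open Summit.RiemannHypothesis.RiemannHypothesis.Theses.RuelleBand
open Literature.NumberTheory.LFunctions

/-- Real part of the de Bruijn substitution `s = 1/2 + iz/2`. [folklore] -/
theorem re_deBruijnSubst (z : ℂ) : (1 / 2 + I * z / 2 : ℂ).re = (1 - z.im) / 2 := by
  simp only [add_re, div_ofNat_re, one_re, mul_re, I_re, I_im, zero_mul, one_mul, zero_sub]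
  ring

/-- Imaginary part of the de Bruijn substitution `s = 1/2 + iz/2`. [folklore] -/
theorem im_deBruijnSubst (z : ℂ) : (1 / 2 + I * z / 2 : ℂ).im = z.re / 2 := by
  simp only [add_im, div_ofNat_im, one_im, mul_im, I_re, I_im, zero_mul, one_mul, zero_add, zero_div]

/-- Zeros of `H_0` are exactly the points `z` with `ζ(1/2 + iz/2) = 0` in the open strip
(`H_0 = ξ(1/2 + iz/2)/8`, `deBruijnH_zero_eq_holds`; `ξ = 0 ⟺ ζ = 0 ∧ 0 < re < 1`,
`riemannXi_eq_zero_iff_holds`). [cite: Titchmarsh1986, §10.1] -/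
theorem deBruijnH_zero_eq_zero_iff' (z : ℂ) :
    deBruijnH 0 z = 0 ↔
      riemannZeta (1 / 2 + I * z / 2) = 0 ∧ 0 < (1 - z.im) / 2 ∧ (1 - z.im) / 2 < 1 := by
  rw [deBruijnH_zero_eq_holds z, div_eq_zero_iff, or_iff_left (by norm_num), riemannXi_eq_zero_iff_holds,
    re_deBruijnSubst]

/-- **The crux is Ki–Kim–Lee at `t = 0`.** `CofiniteCriticalLine` holds iff there is a threshold `T` beyond
which (in `|Re z|`) every zero of `H_0` is real — verbatim the conclusion of `ki_kim_lee_finite` (Ki–Kim–Lee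
2009, Thm. 1.3, stated there for every `t > 0`) at the excluded endpoint `t = 0`.
[cite: KiKimLee2009, Thm. 1.3] -/
theorem cofiniteCriticalLine_iff_kiKimLee_at_zero :
    CofiniteCriticalLine ↔ ∃ T : ℝ, ∀ z : ℂ, deBruijnH 0 z = 0 → T ≤ |z.re| → z.im = 0 := by
  constructor
  · intro h
    obtain ⟨T, hT⟩ := (Set.Finite.image (fun s : ℂ => |s.im|) h).bddAbove
    refine ⟨2 * |T| + 1, fun z hz hre => ?_⟩
    obtain ⟨hζ, h0, h1⟩ := (deBruijnH_zero_eq_zero_iff' z).1 hz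
    by_contra him
    have hmem : (1 / 2 + I * z / 2 : ℂ) ∈
        {s : ℂ | riemannZeta s = 0 ∧ 0 < s.re ∧ s.re < 1 ∧ s.re ≠ 1 / 2} := by
      refine ⟨hζ, ?_, ?_, ?_⟩
      · rw [re_deBruijnSubst]; exact h0
      · rw [re_deBruijnSubst]; exact h1
      · rw [re_deBruijnSubst]; intro h'; apply him; linarith
    have hle : |(1 / 2 + I * z / 2 : ℂ).im| ≤ T := hT ⟨_, hmem, rfl⟩
    rw [im_deBruijnSubst, abs_div, abs_two] at hle
    linarith [le_abs_self T, abs_nonneg z.re]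
  · rintro ⟨T, hT⟩
    refine (((isCompact_Icc (a := (0 : ℝ)) (b := 1)).reProdIm
      (isCompact_Icc (a := -|T|) (b := |T|))).inter_riemannZetaZeros_finite).subset ?_
    rintro s ⟨hζ, h0, h1, hne⟩
    refine ⟨Complex.mem_reProdIm.2 ⟨⟨h0.le, h1.le⟩, abs_le.1 ?_⟩, hζ⟩
    refine le_of_not_gt fun hlt => ?_
    set z : ℂ := ((2 * s.im : ℝ) : ℂ) + ((1 - 2 * s.re : ℝ) : ℂ) * I with hz
    have hzre : z.re = 2 * s.im := by simp [hz]
    have hzim : z.im = 1 - 2 * s.re := by simp [hz]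
    have hs : (1 / 2 + I * z / 2 : ℂ) = s := by
      apply Complex.ext
      · rw [re_deBruijnSubst, hzim]; ring
      · rw [im_deBruijnSubst, hzre]; ring
    have hz0 : deBruijnH 0 z = 0 := by
      rw [deBruijnH_zero_eq_zero_iff', hs, hzim]
      exact ⟨hζ, by linarith, by linarith⟩
    have hreal := hT z hz0 (by rw [hzre, abs_mul, abs_two]; linarith [le_abs_self T, abs_nonneg s.im])
    rw [hzim] at hreal
    apply hne
    linarith

/-- Corollary: "all but finitely many zeros of `H_t` are real for every `t ≥ 0`" (Ki–Kim–Lee's theorem on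
the CLOSED half-line) is exactly Ki–Kim–Lee's theorem (`t > 0`, the named fact) together with the crux.
[cite: KiKimLee2009, Thm. 1.3] -/
theorem kiKimLee_closed_iff :
    (∀ t : ℝ, 0 ≤ t → ∃ T : ℝ, ∀ z : ℂ, deBruijnH t z = 0 → T ≤ |z.re| → z.im = 0) ↔
      ki_kim_lee_finite ∧ CofiniteCriticalLine := by
  rw [cofiniteCriticalLine_iff_kiKimLee_at_zero]
  refine ⟨fun h => ⟨fun t ht => h t ht.le, h 0 le_rfl⟩, fun h t ht => ?_⟩
  rcases ht.eq_or_lt with rfl | hpos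
  · exact h.2
  · exact h.1 t hpos

end Summit.RiemannHypothesis.Cruxes.CofiniteCriticalLine.Negative

end
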